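import Summits.QuantumFields.YangMills.Theorems.AlphaInputsT3ACv3OneBlockLiftDefs
import HarnessLib

/-!
# `AlphaInputsT3ACv3OneBlockLiftTube` — (r1-ob) THE ONE-BLOCK LIFT, PART 1: the 1D sums and ★ the TUBE SUMS of the product form `e⁰_{(y,α)}` are `(L^k)³·δ_{(y,α)}` — lane
# `pub-balaban3d` ∕ cell `ym3-torus`, seat alpha-2 (g6); kernel of record for the regional Newton route (★★OWNER g25 03:01:17Z, LEAD ★w1-19936 g2 03:02:18Z)

WHY (`…v3OneBlockLiftDefs`, HOME `pub-balaban3d/ONE-BLOCK-KERNEL-alpha2-g6.md`).  Exactness of the one-block kernel (sibling `…v3OneBlockLift`) rests on `M^k e⁰ = δ`, i.e. on the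
tube sums of the product form: along its own block the fine lines from offset `r` collect `1 − G(r)` of the hosted profile (block sum `n − ΣG = n`, `…v3AbelianShapes1D`), along
the previous block `G(r)` (block sum `0`), the transverse tents sum to `n` over their own block and to `0` over every other, and every other tube misses the support.
WHAT.  §1 `tentW_nonneg`, `tentZ_pos`, `sum_tentV` (mean one), `sum_block_tS`, `sum_sum_hS_false` (the profile summed along a tube); §2 `N0_sub_eq`, `add_sub_mod_eq_zero_iff`,
★ `rho_mod_lt_iff` (offset in the home window ↔ site in the block), `hosted_eq_zero_of_ne`, `rho_bsite`, `blockIdx_mod_eq_zero_iff`, `rho_shiftN_mod`, ★★ `tubeSum_e0`.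
HONEST FRAMING.  Kernel algebra of explicit lattice functions; count-neutral helper toward the (FL)∕KIN row `hLift` of R3 2′∕2′χ (`stub_laneRecordsV3`, items 19935∕19936 — NOT
proved here); registry untouched; nothing about d = 4, the continuum limit, or a mass gap; YM₃ on T³ is rung R3, not the Clay problem.

References: T. Bałaban, Commun. Math. Phys. 109 (1987) 249–301 [Balaban1987RG1] ((0.3) p.252, (0.4)+(0.11) p.253); CMP 102 (1985) 277–309 [Balaban1985Variational] ((8) p.279).
-/

set_option autoImplicit false

noncomputable section

namespace Summit.QuantumFields.YangMills.Theorems.AbelianEML.OneBlock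

open scoped BigOperators
open Literature.MathematicalPhysics.QuantumFieldTheory.Balaban1983to89
open Literature.MathematicalPhysics.QuantumFieldTheory.Balaban1983to89.T3ContinuumYM3Torus
open Literature.MathematicalPhysics.QuantumFieldTheory.Balaban1983to89.B10Eq38TorusDomains (toFine)
open Literature.MathematicalPhysics.QuantumFieldTheory.Balaban1983to89.B10Eq47AxialChi (shiftN shiftN_zero shiftN_succ)
open Literature.MathematicalPhysics.QuantumFieldTheory.Balaban1983to89.BlockAveragingEMLProp2 (shiftN_apply)
open Literature.MathematicalPhysics.QuantumFieldTheory.Balaban1983to89.B5Eq118OneStroke (iterBlockOf)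
open Summit.QuantumFields.YangMills.Theorems.AbelianEML.Shapes1D
open Summit.QuantumFields.YangMills.Theorems.AbelianEML.Tensor (rho form3 N0 nc sizes le_standing coarsen_eq_iff val_bsite3 rho_tube_ne tubeSum_form3 rho_shift_mod)
open Summit.QuantumFields.Balaban3D.Carriers (coarsen)

/-! ## §1 The 1D sums: mean-one tent, and the hosted profile summed along a tube -/

section OneD

variable {n N nc : ℕ} (hN : N = n * nc) (hnc : 2 ≤ nc) (hn : 1 ≤ n)

/-- The tent weights are non-negative. [folklore] -/
theorem tentW_nonneg (n r : ℕ) : 0 ≤ tentW n r := Nat.cast_nonneg _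

/-- For `n ≥ 3` the total tent weight is positive (the offset `1` carries weight `1`). [folklore] -/
theorem tentZ_pos (hn3 : 3 ≤ n) : 0 < tentZ n := by
  unfold tentZ
  have h1 : (1 : ℕ) ∈ Finset.range n := Finset.mem_range.mpr (by omega)
  have hw1 : tentW n 1 = 1 := by
    unfold tentW
    have : min 1 (n - 1 - 1) = 1 := by omega
    rw [this]; norm_num
  calc (0 : ℝ) < tentW n 1 := by rw [hw1]; norm_num
    _ ≤ ∑ r ∈ Finset.range n, tentW n r := Finset.single_le_sum (fun r _ => tentW_nonneg n r) h1

/-- **THE TENT HAS MEAN ONE**: `Σ_{r<n} tentV n r = n` (`n ≥ 3`). [cite: Balaban1985Variational, (8) p.279] -/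
theorem sum_tentV (hn3 : 3 ≤ n) : ∑ r ∈ Finset.range n, tentV n r = n := by
  have hZ := (tentZ_pos hn3).ne'
  unfold tentV
  rw [← Finset.sum_div, ← Finset.mul_sum]
  show (n : ℝ) * tentZ n / tentZ n = n
  field_simp

include hN hnc hn in
/-- **THE HOSTED TENT SUMS TO `n` OVER ITS OWN BLOCK AND TO `0` OVER EVERY OTHER**: `Σ_{j<n} tS(nb + j) = [b ≡ 0 mod n_c]·n` (`n ≥ 3`). [cite: Balaban1987RG1, (0.3) p.252] -/
theorem sum_block_tS (hn3 : 3 ≤ n) (b : ℕ) : ∑ j ∈ Finset.range n, tS n N (n * b + j) = if b % nc = 0 then (n : ℝ) else 0 := by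
  have key : ∀ j ∈ Finset.range n, tS n N (n * b + j) = if b % nc = 0 then tentV n j else 0 := by
    intro j hj
    rw [Finset.mem_range] at hj
    simp only [tS, per, window_mod hN hnc hn hj]
    by_cases h0 : b % nc = 0
    · rw [h0, mul_zero, zero_add, if_pos hj, if_pos rfl]
    · have hcond : ¬ (n * (b % nc) + j < n) := by
        have : 1 ≤ b % nc := Nat.one_le_iff_ne_zero.mpr h0
        nlinarith
      rw [if_neg hcond, if_neg h0]
  rw [Finset.sum_congr rfl key]
  by_cases h0 : b % nc = 0
  · simp only [h0, if_true]; exact sum_tentV hn3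
  · simp [h0]

include hN hnc hn in
/-- **THE HOSTED PROFILE SUMMED ALONG A TUBE**: `Σ_{r<n} Σ_{t<n} h⁰(nb + r + t) = [b ≡ 0 mod n_c]·n` — over its own block the fine lines from offset `r` collect `1 − G(r)`
(block sum `n − ΣG = n`), over the previous block they collect `G(r)` (block sum `0`), no other block is met. [cite: Balaban1985Variational, (8) p.279] -/
theorem sum_sum_hS_false (b : ℕ) :
    ∑ r ∈ Finset.range n, ∑ t ∈ Finset.range n, hS false n N (n * b + r + t) = if b % nc = 0 then (n : ℝ) else 0 := by
  -- the profile on the window `nb + s`, `s < 2n`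
  have lo : ∀ s, s < n → hS false n N (n * b + s) = if b % nc = 0 then hprof n s else 0 := by
    intro s hs
    simp only [hS, per, window_mod hN hnc hn hs, Bool.false_eq_true, if_false]
    by_cases h0 : b % nc = 0
    · rw [h0, mul_zero, zero_add, if_pos hs, if_pos rfl]
    · have hcond : ¬ (n * (b % nc) + s < n) := by
        have : 1 ≤ b % nc := Nat.one_le_iff_ne_zero.mpr h0
        nlinarith
      rw [if_neg hcond, if_neg h0]
  have hi : ∀ u, u < n → hS false n N (n * b + (n + u)) = if (b + 1) % nc = 0 then hprof n u else 0 := by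
    intro u hu
    have e : n * b + (n + u) = n * (b + 1) + u := by ring
    rw [e]
    simp only [hS, per, window_mod hN hnc hn hu, Bool.false_eq_true, if_false]
    by_cases h0 : (b + 1) % nc = 0
    · rw [h0, mul_zero, zero_add, if_pos hu, if_pos rfl]
    · have hcond : ¬ (n * ((b + 1) % nc) + u < n) := by
        have : 1 ≤ (b + 1) % nc := Nat.one_le_iff_ne_zero.mpr h0
        nlinarith
      rw [if_neg hcond, if_neg h0]
  -- split the inner sum at `t = n − r`
  have inner : ∀ r ∈ Finset.range n, ∑ t ∈ Finset.range n, hS false n N (n * b + r + t) =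
      (if b % nc = 0 then (1 - Gprof n r) else 0) + (if (b + 1) % nc = 0 then Gprof n r else 0) := by
    intro r hr
    rw [Finset.mem_range] at hr
    have hsplit : n = (n - r) + r := by omega
    rw [show Finset.range n = Finset.range ((n - r) + r) by rw [← hsplit], Finset.sum_range_add]
    congr 1
    · -- `t < n − r`: offsets `r + t < n` of the own block
      have h1 : ∑ t ∈ Finset.range (n - r), hS false n N (n * b + r + t) = ∑ t ∈ Finset.range (n - r), (if b % nc = 0 then hprof n (r + t) else 0) :=
        Finset.sum_congr rfl fun t ht => by
          rw [Finset.mem_range] at ht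
          rw [show n * b + r + t = n * b + (r + t) by ring, lo (r + t) (by omega)]
      rw [h1]
      by_cases h0 : b % nc = 0
      · simp only [h0, if_true]
        have hG : Gprof n (r + (n - r)) = Gprof n r + ∑ t ∈ Finset.range (n - r), hprof n (r + t) := by
          unfold Gprof; rw [Finset.sum_range_add]
        rw [show r + (n - r) = n by omega, Gprof_self hn] at hG
        linarith
      · simp [h0]
    · -- `t = (n − r) + u`, `u < r`: offsets `u` of the next block
      have h1 : ∑ u ∈ Finset.range r, hS false n N (n * b + r + ((n - r) + u)) = ∑ u ∈ Finset.range r, (if (b + 1) % nc = 0 then hprof n u else 0) :=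
        Finset.sum_congr rfl fun u hu => by
          rw [Finset.mem_range] at hu
          rw [show n * b + r + ((n - r) + u) = n * b + (n + u) by omega, hi u (by omega)]
      rw [h1]
      by_cases h0 : (b + 1) % nc = 0
      · simp only [h0, if_true]; rfl
      · simp [h0]
  rw [Finset.sum_congr rfl inner, Finset.sum_add_distrib]
  have hA : ∑ r ∈ Finset.range n, (if b % nc = 0 then (1 - Gprof n r) else 0) = if b % nc = 0 then (n : ℝ) else 0 := by
    by_cases h0 : b % nc = 0
    · simp only [h0, if_true, Finset.sum_sub_distrib, Finset.sum_const, Finset.card_range, nsmul_eq_mul, mul_one, sum_Gprof_self hn, sub_zero]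
    · simp [h0]
  have hB : ∑ r ∈ Finset.range n, (if (b + 1) % nc = 0 then Gprof n r else 0) = 0 := by
    by_cases h0 : (b + 1) % nc = 0
    · simp only [h0, if_true, sum_Gprof_self hn]
    · simp [h0]
  rw [hA, hB, add_zero]

end OneD

/-! ## §2 The tube sums of the product form -/

section Tube

variable {F : T3Family} {K k : ℕ}

/-- `N₀ − L^k·y_i = L^k·(n_c − y_i)` (`y_i < n_c`). [folklore] -/
theorem N0_sub_eq (hk : k ≤ K) (y : Site (F.P K) k) (i : Fin 3) : N0 F K - F.L ^ k * (y i).val = F.L ^ k * (nc F K k - (y i).val) := by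
  obtain ⟨h1, -, -⟩ := sizes (F := F) hk
  rw [h1, Nat.mul_sub]

/-- Arithmetic: for `q, y < c`, `q + (c − y) ≡ 0 (mod c)` iff `q = y`. [folklore] -/
theorem add_sub_mod_eq_zero_iff {q y c : ℕ} (hq : q < c) (hy : y < c) : (q + (c - y)) % c = 0 ↔ q = y := by
  rcases Nat.lt_or_ge q y with hlt | hge
  · -- `q < y`: `q + (c − y) < c` and it is positive
    have h1 : q + (c - y) < c := by omega
    rw [Nat.mod_eq_of_lt h1]
    omega
  · -- `y ≤ q`: `q + (c − y) = c + (q − y)` with `q − y < c`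
    have h1 : q + (c - y) = c + (q - y) := by omega
    rw [h1, Nat.add_mod_left, Nat.mod_eq_of_lt (by omega)]
    omega

/-- **THE OFFSET LIES IN THE HOME WINDOW IFF THE SITE LIES IN THE BLOCK (coordinatewise)**: `ρ_i(y,z) mod N₀ < L^k ↔ z_i div L^k = y_i`. [cite: Balaban1987RG1, (0.3) p.252] -/
theorem rho_mod_lt_iff (hk : k ≤ K) (y : Site (F.P K) k) (z : Site (F.P K) 0) (i : Fin 3) :
    rho y z i % N0 F K < F.L ^ k ↔ (z i).val / F.L ^ k = (y i).val := by
  obtain ⟨h1, h2, h3⟩ := sizes (F := F) hk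
  have hy : (y i).val < nc F K k := ZMod.val_lt (y i)
  have hz : (z i).val < N0 F K := ZMod.val_lt (z i)
  have hzqs : (z i).val = F.L ^ k * ((z i).val / F.L ^ k) + (z i).val % F.L ^ k := (Nat.div_add_mod _ _).symm
  have hs' : (z i).val % F.L ^ k < F.L ^ k := Nat.mod_lt _ (by omega)
  have hqlt : (z i).val / F.L ^ k < nc F K k := Nat.div_lt_of_lt_mul (by rw [← h1]; exact hz)
  have e : rho y z i = F.L ^ k * ((z i).val / F.L ^ k + (nc F K k - (y i).val)) + (z i).val % F.L ^ k := by
    unfold rho; rw [N0_sub_eq hk y i]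
    conv_lhs => rw [hzqs]
    ring
  rw [e, window_mod h1 h2 h3 hs', ← add_sub_mod_eq_zero_iff hqlt hy]
  constructor
  · intro h
    by_contra hne
    have h1' : 1 ≤ ((z i).val / F.L ^ k + (nc F K k - (y i).val)) % nc F K k := Nat.one_le_iff_ne_zero.mpr hne
    have h2' : F.L ^ k ≤ F.L ^ k * (((z i).val / F.L ^ k + (nc F K k - (y i).val)) % nc F K k) := by
      simpa using Nat.mul_le_mul_left (F.L ^ k) h1'
    exact absurd h (not_lt.mpr (h2'.trans (Nat.le_add_right _ _)))
  · intro h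
    rw [h, mul_zero, zero_add]
    exact hs'

/-- A shape hosted in the home window vanishes at a site outside the block (coordinate `i`). [folklore] -/
theorem hosted_eq_zero_of_ne (hk : k ≤ K) (G : ℕ → ℝ) (y : Site (F.P K) k) (z : Site (F.P K) 0) (i : Fin 3) (h : (z i).val / F.L ^ k ≠ (y i).val) :
    per (N0 F K) (fun r => if r < F.L ^ k then G r else 0) (rho y z i) = 0 := by
  simp only [per]
  rw [if_neg]
  exact fun hlt => h ((rho_mod_lt_iff hk y z i).mp hlt)

/-- The offset of a block site from `y`: `ρ_i(y, bsite y′ r) = L^k·(y′_i + (n_c − y_i)) + r_i`. [folklore] -/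
theorem rho_bsite (hk : k ≤ K) (y y' : Site (F.P K) k) (r : Fin 3 → Fin (F.L ^ k)) (i : Fin 3) :
    rho y (bsite k y' r) i = F.L ^ k * ((y' i).val + (nc F K k - (y i).val)) + r i := by
  unfold rho; rw [val_bsite3 hk, N0_sub_eq hk y i]; ring

/-- `(y′_i + (n_c − y_i)) ≡ 0 (mod n_c) ↔ y′_i = y_i`. [folklore] -/
theorem blockIdx_mod_eq_zero_iff (y y' : Site (F.P K) k) (i : Fin 3) :
    ((y' i).val + (nc F K k - (y i).val)) % nc F K k = 0 ↔ y' i = y i := by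
  rw [add_sub_mod_eq_zero_iff (ZMod.val_lt (y' i)) (ZMod.val_lt (y i))]
  exact ⟨fun h => ZMod.val_injective _ h, fun h => by rw [h]⟩

/-- Along the tube in direction `α`, the `α`-offset advances by `t` (modulo the period). [folklore] -/
theorem rho_shiftN_mod (y : Site (F.P K) k) (z : Site (F.P K) 0) (α : Fin 3) :
    ∀ t : ℕ, rho y (shiftN z α t) α % N0 F K = (rho y z α + t) % N0 F K
  | 0 => by simp [shiftN_zero]
  | t + 1 => by
    rw [shiftN_succ, rho_shift_mod, if_pos rfl, Nat.add_mod, rho_shiftN_mod y z α t, ← Nat.add_mod, add_assoc]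

open scoped Classical in
/-- **★ THE TUBE SUMS OF THE PRODUCT FORM ARE `(L^k)³·δ`**: `tubeSum k (e⁰_{(y,α)}) (y′, μ) = (L^k)³·[y′ = y ∧ μ = α]` (`L^k ≥ 3`). [cite: Balaban1985Variational, (8) p.279] -/
theorem tubeSum_e0 (hk : k ≤ K) (hn3 : 3 ≤ F.L ^ k) (y y' : Site (F.P K) k) (α μ : Fin 3) :
    tubeSum k (e0 F K k y α) ⟨y', μ⟩ = if y' = y ∧ μ = α then ((F.L : ℝ) ^ k) ^ 3 else 0 := by
  obtain ⟨h1, h2, h3⟩ := sizes (F := F) hk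
  unfold e0
  rw [tubeSum_form3]
  by_cases hμ : μ = α
  · rw [← hμ]
    simp only [if_true, and_true]
    -- the block index of `y′` relative to `y`, per coordinate
    set B : Fin 3 → ℕ := fun i => (y' i).val + (nc F K k - (y i).val) with hB
    -- the summand as a product over the three coordinates, after summing `t`
    set f : Fin 3 → Fin (F.L ^ k) → ℝ := fun i j =>
      if i = μ then ∑ t : Fin (F.L ^ k), hS false (F.L ^ k) (N0 F K) (F.L ^ k * B μ + j + t)
      else tS (F.L ^ k) (N0 F K) (F.L ^ k * B i + j) with hf
    have hfμ : ∀ j : Fin (F.L ^ k), f μ j = ∑ t : Fin (F.L ^ k), hS false (F.L ^ k) (N0 F K) (F.L ^ k * B μ + j + t) := by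
      intro j; rw [hf]; simp only [if_true]
    have hfi : ∀ {i : Fin 3}, i ≠ μ → ∀ j : Fin (F.L ^ k), f i j = tS (F.L ^ k) (N0 F K) (F.L ^ k * B i + j) := by
      intro i hi j; rw [hf]; simp only [hi, if_false]
    have hsummand : ∀ r : Fin 3 → Fin (F.L ^ k),
        ∑ t : Fin (F.L ^ k), hS false (F.L ^ k) (N0 F K) (rho y (shiftN (bsite k y' r) μ t) μ) *
          ∏ i ∈ Finset.univ.erase μ, tS (F.L ^ k) (N0 F K) (rho y (shiftN (bsite k y' r) μ t) i) = ∏ i, f i (r i) := by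
      intro r
      have htrans : ∀ t : Fin (F.L ^ k), ∏ i ∈ Finset.univ.erase μ, tS (F.L ^ k) (N0 F K) (rho y (shiftN (bsite k y' r) μ t) i) =
          ∏ i ∈ Finset.univ.erase μ, f i (r i) := by
        intro t
        refine Finset.prod_congr rfl fun i hi => ?_
        have hiμ : i ≠ μ := Finset.ne_of_mem_erase hi
        rw [hfi hiμ, rho_tube_ne hk y y' r hiμ t, N0_sub_eq hk y i]
        congr 1; ring
      have hlong : ∀ t : Fin (F.L ^ k), hS false (F.L ^ k) (N0 F K) (rho y (shiftN (bsite k y' r) μ t) μ) =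
          hS false (F.L ^ k) (N0 F K) (F.L ^ k * B μ + r μ + t) := by
        intro t
        apply hS_congr
        rw [rho_shiftN_mod, rho_bsite hk]
      simp_rw [htrans, hlong]
      rw [← Finset.sum_mul, ← hfμ]
      exact Finset.mul_prod_erase Finset.univ (fun i => f i (r i)) (Finset.mem_univ μ)
    rw [Finset.sum_congr rfl fun r _ => hsummand r, ← Fintype.prod_sum]
    -- each coordinate factor
    have hcast : ((F.L ^ k : ℕ) : ℝ) = (F.L : ℝ) ^ k := by push_cast; ring
    have hfac : ∀ i, ∑ j : Fin (F.L ^ k), f i j = if B i % nc F K k = 0 then ((F.L : ℝ) ^ k) else 0 := by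
      intro i
      by_cases hi : i = μ
      · rw [hi]
        simp_rw [hfμ]
        have e2 : ∀ j : ℕ, ∑ t : Fin (F.L ^ k), hS false (F.L ^ k) (N0 F K) (F.L ^ k * B μ + j + t) =
            ∑ t ∈ Finset.range (F.L ^ k), hS false (F.L ^ k) (N0 F K) (F.L ^ k * B μ + j + t) :=
          fun j => Fin.sum_univ_eq_sum_range (fun t => hS false (F.L ^ k) (N0 F K) (F.L ^ k * B μ + j + t)) _
        simp_rw [e2]
        rw [Fin.sum_univ_eq_sum_range (fun j => ∑ t ∈ Finset.range (F.L ^ k), hS false (F.L ^ k) (N0 F K) (F.L ^ k * B μ + j + t)),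
          sum_sum_hS_false h1 h2 h3, hcast]
      · simp_rw [hfi hi]
        rw [Fin.sum_univ_eq_sum_range (fun j => tS (F.L ^ k) (N0 F K) (F.L ^ k * B i + j)), sum_block_tS h1 h2 h3 hn3, hcast]
    simp_rw [hfac]
    -- the product of the three indicators
    by_cases hy : y' = y
    · have hall : ∀ i, B i % nc F K k = 0 := fun i => (blockIdx_mod_eq_zero_iff y y' i).mpr (by rw [hy])
      simp only [hall, if_true, Finset.prod_const, Finset.card_univ, Fintype.card_fin]
      rw [if_pos hy]
    · have hne : ¬ ∀ i, y' i = y i := fun hcon => hy (funext hcon)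
      obtain ⟨i, hi⟩ := not_forall.mp hne
      have hBi : B i % nc F K k ≠ 0 := fun h => hi ((blockIdx_mod_eq_zero_iff y y' i).mp h)
      have h0 : (if B i % nc F K k = 0 then ((F.L : ℝ) ^ k) else 0) = 0 := by rw [if_neg hBi]
      have hprod : (∏ x : Fin 3, if B x % nc F K k = 0 then ((F.L : ℝ) ^ k) else 0) = 0 := Finset.prod_eq_zero (Finset.mem_univ i) h0
      rw [hprod, if_neg hy]
  · simp [hμ]

end Tube

end Summit.QuantumFields.YangMills.Theorems.AbelianEML.OneBlock

end
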